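import Summits.MatrixMultiplication.MatrixMultiplication.Theorems.SoloInformedCwTwoForms
import HarnessLib

/-!
# Degeneration certificates modulo `p`, and `T_{cw,2} ⊵ N₃` in characteristic `2` (solo-informed, gen 27)

`SoloInformedDegenerationCertificate` checks INTEGER certificates `(A ⊗ B ⊗ C)·S = ε^h·D·T + O(ε^{h+1})`
exactly over `ℤ`, giving `S ⊵ T` wherever the multiplier `D` is a unit.  Some degenerations exist ONLY
in characteristic `p` and have no such lift (e.g. `T_{cw,2} ⊵ N₃` holds in characteristic `2` but
fails over `ℚ`, where `-1` is not a square).  This file adds the `p`-modular variant: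

* `DegenCert.checkMod p …` — the same closed computation of the integer entry polynomials, but each
  coefficient is compared with `0, …, 0, T_{i'j'l'}` MODULO `p`;
* `DegenCert.isPolyDegen_of_checkMod` / `DegenCert.polyDegeneratesTo_of_checkMod` — soundness over every
  commutative ring `K` with `(p : K) = 0`;
* client: `cwTwo_nurmiev_3_mod2_check` (an order-`3` certificate over `𝔽₂`, found by SAT on the native
  `𝔽₂` encoding and verified independently) and
  `cwTensor_two_polyDegeneratesTo_nurmiev_three_of_two_eq_zero` — **over every commutative ring of
  characteristic `2`, `T_{cw,2} ⊵ N₃`**, the generic class of Nurmiev's nullcone; by contrast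
  `P ⋭ N₃` in characteristic `2` (`sThree_polyDegeneratesTo_nurmiev_iff_of_two_eq_zero`) and
  `T_{cw,2} ⋭ N₃` over any field of characteristic `≠ 2` without `√-1` (paper theorem (F3), gen 26).
-/

noncomputable section

open scoped BigOperators Polynomial
open Polynomial

namespace Summit.MatrixMultiplication.MatrixMultiplication.Theorems

open Literature.Computability.AlgebraicComplexity
open Literature.Computability.AlgebraicComplexity.Smirnov2013 (toPoly coeffL coeff_toPoly)
open Literature.Barriers.MatrixMultiplication (polySubst IsPolyDegen PolyDegeneratesTo)

namespace DegenCert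

/-- **The certificate check modulo `p`**: every target entry polynomial (computed over `ℤ` modulo
`ε^{h+1}`) has coefficients `≡ 0, …, 0, T i' j' l'` modulo `p` in degrees `0, …, h`.  A closed Boolean
computation, evaluated by `decide +kernel`. [cite: Alman2021, §2.4] -/
def checkMod (p : ℕ) (a b c a' b' c' h : ℕ) (S : Fin a → Fin b → Fin c → ℤ)
    (T : Fin a' → Fin b' → Fin c' → ℤ) (A : Fin a → Fin a' → List ℤ) (B : Fin b → Fin b' → List ℤ)
    (C : Fin c → Fin c' → List ℤ) : Bool :=
  (List.finRange a').all fun i' => (List.finRange b').all fun j' => (List.finRange c').all fun l' =>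
    (List.range (h + 1)).all fun d =>
      (coeffL (entryPoly (h + 1) S (fun i => A i i') (fun j => B j j') (fun l => C l l')) d -
        (if d = h then T i' j' l' else 0)) % (p : ℤ) == 0

/-- Unpacking a successful modular check. [cite: Alman2021, §2.4] -/
theorem dvd_of_checkMod {p a b c a' b' c' h : ℕ} {S : Fin a → Fin b → Fin c → ℤ}
    {T : Fin a' → Fin b' → Fin c' → ℤ} {A : Fin a → Fin a' → List ℤ} {B : Fin b → Fin b' → List ℤ}
    {C : Fin c → Fin c' → List ℤ} (hc : checkMod p a b c a' b' c' h S T A B C = true) (i' : Fin a')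
    (j' : Fin b') (l' : Fin c') {d : ℕ} (hd : d ≤ h) :
    (p : ℤ) ∣ coeffL (entryPoly (h + 1) S (fun i => A i i') (fun j => B j j') (fun l => C l l')) d -
        (if d = h then T i' j' l' else 0) := by
  simp only [checkMod, List.all_eq_true, beq_iff_eq] at hc
  exact Int.dvd_of_emod_eq_zero (hc i' (List.mem_finRange i') j' (List.mem_finRange j') l'
    (List.mem_finRange l') d (List.mem_range.mpr (by omega)))

/-- **Soundness modulo `p`.** A successful modular check is an order-`h` degeneration `S ⊵_h T` over
`K[ε]` for every commutative ring `K` with `(p : K) = 0`. [cite: Alman2021, §2.4] -/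
theorem isPolyDegen_of_checkMod {K : Type*} [CommRing K] {p a b c a' b' c' h : ℕ} (hp : (p : K) = 0)
    {S : Fin a → Fin b → Fin c → ℤ} {T : Fin a' → Fin b' → Fin c' → ℤ} {A : Fin a → Fin a' → List ℤ}
    {B : Fin b → Fin b' → List ℤ} {C : Fin c → Fin c' → List ℤ}
    (hc : checkMod p a b c a' b' c' h S T A B C = true) :
    IsPolyDegen h (fun i j l => ((S i j l : ℤ) : K)) (fun i' j' l' => ((T i' j' l' : ℤ) : K))
      (fun i i' => toPoly (A i i')) (fun j j' => toPoly (B j j')) (fun l l' => toPoly (C l l')) := by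
  intro i' j' l' d hd
  rw [polySubst_eq_sum, ← coeff_toPoly_entryPoly K (h + 1) S (fun i => A i i') (fun j => B j j')
    (fun l => C l l') d (by omega), coeff_toPoly]
  obtain ⟨m, hm⟩ := dvd_of_checkMod hc i' j' l' hd
  have key : ((coeffL (entryPoly (h + 1) S (fun i => A i i') (fun j => B j j') (fun l => C l l')) d
      : ℤ) : K) = (((if d = h then T i' j' l' else 0 : ℤ)) : K) := by
    rw [← sub_eq_zero, ← Int.cast_sub, hm, Int.cast_mul, Int.cast_natCast, hp, zero_mul]
  rw [key]
  split_ifs <;> simp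

/-- **`S ⊵ T` in characteristic `p`** from a certificate checked modulo `p`: over every commutative
ring `K` with `(p : K) = 0`. [cite: Alman2021, §2.4] -/
theorem polyDegeneratesTo_of_checkMod (K : Type*) [CommRing K] {p a b c a' b' c' h : ℕ}
    (hp : (p : K) = 0) {S : Fin a → Fin b → Fin c → ℤ} {T : Fin a' → Fin b' → Fin c' → ℤ}
    {A : Fin a → Fin a' → List ℤ} {B : Fin b → Fin b' → List ℤ} {C : Fin c → Fin c' → List ℤ}
    (hc : checkMod p a b c a' b' c' h S T A B C = true) :
    PolyDegeneratesTo (fun i j l => ((S i j l : ℤ) : K)) (fun i' j' l' => ((T i' j' l' : ℤ) : K)) :=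
  (isPolyDegen_of_checkMod hp hc).polyDegeneratesTo

/-- Sanity: the modular check at `p = 0` is the exact check with multiplier `1` on the classical
`⟨2⟩ ⊵ W`. [cite: BurgisserClausenShokrollahi1997, (15.20)] -/
theorem unitTwo_wState_checkMod_zero :
    checkMod 0 2 2 2 2 2 2 1 unitTwoInt wStateInt ![![[1], [0, 1]], ![[-1], []]]
      ![![[1], [0, 1]], ![[1], []]] ![![[1], [0, 1]], ![[1], []]] = true := by
  decide +kernel

end DegenCert

/-! ## `T_{cw,2} ⊵ N₃` in characteristic `2` -/

/-- An order-`3` certificate `T_{cw,2} ⊵ N₃` MODULO `2` (it is not a certificate over `ℤ`: the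
degeneration fails over `ℚ`).  Found by SAT (kissat, 0.24 s) on the native `𝔽₂` encoding of
`(A ⊗ B ⊗ C)·T_{cw,2} ≡ ε³ N₃ (mod ε⁴, 2)` and verified independently (solo-informed gen 27,
work/g27/char2, job j195440). [cite: Nurmiev2000, Table 2] -/
theorem cwTwo_nurmiev_3_mod2_check :
    DegenCert.checkMod 2 3 3 3 3 3 3 3 CayleyOmega.cwTwoInt (nurmievInt 3)
      ![![[1], [], [0, 0, 0, 1]], ![[], [1], []], ![[1], [0, 0, 1], []]]
      ![![[1], [], [0, 0, 0, 1]], ![[0, 0, 1], [1], []], ![[1], [0, 0, 1], []]]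
      ![![[], [], [0, 0, 0, 1]], ![[0, 0, 1], [], []], ![[1], [0, 1], []]] = true := by
  decide +kernel

/-- **`T_{cw,2} ⊵ N₃` over every commutative ring of characteristic `2`.**  (`N₃` is the generic
class of Nurmiev's nullcone; `P = ∑_σ e_σ` does NOT degenerate to it in characteristic `2`, and
neither does `T_{cw,2}` over a field of characteristic `≠ 2` in which `-1` is not a square.)
[cite: Nurmiev2000, Table 2] -/
theorem cwTensor_two_polyDegeneratesTo_nurmiev_three_of_two_eq_zero (K : Type*) [CommRing K]
    (h2 : (2 : K) = 0) : PolyDegeneratesTo (cwTensor K 2) (nurmiev K 3) := by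
  rw [CayleyOmega.cwTensor_two_eq_cast]
  exact DegenCert.polyDegeneratesTo_of_checkMod K (p := 2) (by exact_mod_cast h2)
    cwTwo_nurmiev_3_mod2_check

/-- **The two `ℤ`-forms of the door differ on the generic boundary class in characteristic `2`**:
over a field with `2 = 0`, `T_{cw,2} ⊵ N₃` and `P ⋭ N₃`. [cite: Nurmiev2000, Table 2] -/
theorem cwTensor_two_not_sThree_nurmiev_three_of_two_eq_zero (K : Type*) [Field K]
    (h2 : (2 : K) = 0) :
    PolyDegeneratesTo (cwTensor K 2) (nurmiev K 3) ∧ ¬ PolyDegeneratesTo (sThree K) (nurmiev K 3) := by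
  refine ⟨cwTensor_two_polyDegeneratesTo_nurmiev_three_of_two_eq_zero K h2, fun h => ?_⟩
  rw [sThree_polyDegeneratesTo_nurmiev_iff_of_two_eq_zero K h2 (by norm_num) (by norm_num)] at h
  simp at h

end Summit.MatrixMultiplication.MatrixMultiplication.Theorems

end
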